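import Summits.ResolutionOfSingularities.ResolutionOfSingularities.Theorems.HomologicalConductorNoZenoCoarseningThread
import Summits.ResolutionOfSingularities.ResolutionOfSingularities.Theorems.HomologicalConductorNoZenoDominanceInvariance
import Summits.ResolutionOfSingularities.ResolutionOfSingularities.Theorems.HomologicalConductorNoZenoIffKernel
import Literature.AlgebraicGeometry.Resolution.CompositeValuations
import Literature.AlgebraicGeometry.Resolution.PrimeDivisors
import HarnessLib

/-!
# Crux `NoZenoR` / `NoZeno` (stmt-ResolutionOfSingularities-19943 / -16483), β1 layer:
# the TRACE-SOCLE terminator (port of ideator res-L0-w44-idea-1's card 10 `trace-socle`, Sketch r12 §r12.0–§r12.1, §r12.4–§r12.5)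

`[OURS · L W4.4]` Cell res-hironaka, crux chain W4.4.  Tree port (seat res-L0-w44-stub-1 g8, CHAIN v20 (ρ34e)
«HELPER targets = def-free ports of Sketch §r12») of `L/res-L0-w44-idea-1/Sketch-idea-1-r12.lean`
(sha16 `4a9f7a6f66dee56f`; tri-2 TRIAGE v13.2 R21 PASS-as-PROVED, tri-1 §41.2 SURVIVES), AUTHOR res-L0-w44-idea-1
(technique A); statements and proofs are the ideator's, re-homed under `…Theorems.NoZeno.TraceSocle`, the
sketch's `Dominates` predicate INLINED (`∀ m, ∀ s ∈ tower O A m, s ∈ U ∧ (s⁻¹ ∈ U → s⁻¹ ∈ O)`, the binder of the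
tree's `stub_dominanceInvariance`).  Nothing here is a statement of the manuscript under review (Hironaka 2017);
AI-written, weaker than expert review; support-level, counted 0.

THE LEVER (ideator's words, abridged).  For a tower CONFINED by a valuation ring `W`, a DOMINATOR `U ≤ W` of the
tower is manufactured as the composite `U = W ∘ Ū` (`residueOverringLift W Ū`), `Ū` a valuation ring of `κ(W)`
dominating the residual images of the stages; the terminator is the tree's `Coarsening.relativeACC_tower` run for
the datum `(U, A)` and its coarsening `W`, which only consumes descending chains of `W`-UNITS DRAWN FROM THE
STAGES — so only the TRACE of `Ū` on the trace field has to be Noetherian.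

* `terminates_of_dominator_stageChains` (§r12.1) — threadless tower (radical persistence, `StrictDrop`) + a
  dominator `U ≤ W` + an escape witness into `W` + the chain condition for `U` on `W`-unit chains drawn from the
  stages ⇒ a regular stage (tree: `stub_dominanceInvariance`, `Coarsening.unitCreating_of_noThread`,
  `Coarsening.relativeACC_tower`).
* `dominates_residueLift` (§r12.4) — `W ∘ Ū` dominates the tower when `Ū` contains the stage residues and
  residually dominates.
* `hacc_of_traceChains`, `chain_of_isNoetherianRing`, `chain_of_noetherianTrace`,
  `isNoetherianRing_trace_of_curve` (§r12.5) — the chain condition upstairs from chains of residues in a subset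
  `F ⊆ κ(W)`; Noetherian ⇒ chains stabilise; a valuation ring of a one-variable function field missing an inverse
  is a DVR (tree `isDiscreteValuationRing_of_primeDivisor`).
* plumbing `stage_le`, `inv_mem_stage`, `loc_le` (stage locality / monotonicity are the tree's
  `exists_tower_eq_loc` + `SyzygyFlattening.isLocalRing_locAt` and `d2rc_mem_tower_of_le`), `residue_ne_zero_of_inv_mem`,
  `residue_mul_inv`.

Sequels: `…NoZenoTraceSocleResidual` (residual images, unit lifting, Chevalley in `κ(W)`, the trace field) and
`…NoZenoTraceSocleCurveConfined` (THEOREM A `curveConfined_terminates`, A₁, A₂).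

References: O. Zariski, P. Samuel, *Commutative Algebra* II (1960), VI §14 Thm. 31 [`ZariskiSamuel1960`] (prime
divisors of one-variable fields are discrete; via the tree); C. Chevalley's extension theorem (dominating valuation
rings; via the tree's `exists_valuationSubring_dominates`).
-/

noncomputable section

-- single-problem summit: the doubled namespace component `ResolutionOfSingularities` is forced
set_option linter.dupNamespace false

namespace Summit.ResolutionOfSingularities.ResolutionOfSingularities.Theorems.NoZeno.TraceSocle

open Summit.ResolutionOfSingularities.ResolutionOfSingularities.Theses.HomologicalConductor
open Summit.ResolutionOfSingularities.ResolutionOfSingularities.Theorems.NoZeno.Birth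
open Summit.ResolutionOfSingularities.ResolutionOfSingularities.Theorems.NoZeno.SandwichCluster.Parasite
open Summit.ResolutionOfSingularities.ResolutionOfSingularities.Theorems
open Summit.ResolutionOfSingularities.ResolutionOfSingularities.Theorems.NoZeno
open Literature.AlgebraicGeometry.Resolution
open IsLocalRing

variable {k K : Type} [Field k] [Field K] [Algebra k K]

/-! ## §r12.0 Tower plumbing (tree idioms) -/

/-- Every stage lies in `O`. [tree `mem_valuationSubring_of_mem_tower`] -/
theorem stage_le (O : ValuationSubring K) (A : Subalgebra k K) (hk : ∀ c : k, algebraMap k K c ∈ O)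
    (hAO : A.toSubring ≤ O.toSubring) (m : ℕ) : ∀ x ∈ tower O A m, x ∈ O :=
  fun x hx => mem_valuationSubring_of_mem_tower O hk hAO m x hx

/-- Every stage inverts its `O`-units. [tree `exists_tower_eq_loc`, `inv_mem_locAt`] -/
theorem inv_mem_stage (O : ValuationSubring K) (A : Subalgebra k K) (hk : ∀ c : k, algebraMap k K c ∈ O)
    (hAO : A.toSubring ≤ O.toSubring) (m : ℕ) : ∀ s ∈ tower O A m, s⁻¹ ∈ O → s⁻¹ ∈ tower O A m := by
  intro s hs hsO
  by_cases hs0 : s = 0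
  · rw [hs0, inv_zero]; exact (tower O A m).zero_mem
  have hsO' : s ∈ O := stage_le O A hk hAO m s hs
  obtain ⟨B, hBO, hTB⟩ := exists_tower_eq_loc O A hk hAO m
  rw [hTB, loc_eq_locAt] at hs ⊢
  exact SyzygyFlattening.inv_mem_locAt O B hBO hs
    (SyzygyFlattening.valuation_eq_one_of_inv_mem O hsO' hsO hs0)

/-- `loc W T ⊆ W` for `T ⊆ W`. [tree `locAt_le`] -/
theorem loc_le (W : ValuationSubring K) (T : Subalgebra k K) (hTW : ∀ x ∈ T, x ∈ W) :
    ∀ x ∈ loc W T, x ∈ W := fun x hx => by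
  have h : (loc W T).toSubring ≤ W.toSubring := by
    rw [loc_eq_locAt]; exact SyzygyFlattening.locAt_le W T (fun y hy => hTW y hy)
  exact h hx

/-! ## §r12.1 (PROVED) The STAGE-CHAIN terminator: a dominator `U ≤ W` with an escape witness into `W` and the
descending chain condition on `W`-unit chains DRAWN FROM THE STAGES terminates a threadless tower -/

/-- **STAGE-CHAIN TERMINATOR (PROVED).**  A threadless tower (radical persistence, StrictDrop) with a dominator
`U`, a valuation ring `W ≥ U` into which some stage element escapes (`s⁻¹ ∈ W ∖ O`), and the descending chain
condition for `U` on chains of non-zero `W`-units TAKEN FROM THE STAGES, has a regular stage.  Proof: `tower U A =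
tower O A` (tree `stub_dominanceInvariance`); CT (`Coarsening.unitCreating_of_noThread`) for `W` relative to `O`
puts a non-zero `W`-unit into some `ca(T_M)`; the tree's `Coarsening.relativeACC_tower`, run for the datum `(U, A)`
and its coarsening `W`, consumes only chains from `ca(T_m) ⊆ T_m`, `m ≥ M`.  Refines r11
`terminates_of_discreteDominator` (whose chain binder ranged over ALL of `U`). [this work] -/
theorem terminates_of_dominator_stageChains (hP : PersistenceRadical) (hD : StrictDrop) (p : ℕ)
    (hp : p.Prime) (k K : Type) [Field k] [CharP k p] [Field K] [Algebra k K] (O : ValuationSubring K)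
    (A : Subalgebra k K) (hk : ∀ c : k, algebraMap k K c ∈ O) (hA : A.FG)
    (hfr : IsFractionRing ↥A K) (hAO : A.toSubring ≤ O.toSubring)
    (hthr : ¬ SingularPrimeThread O A) (U W : ValuationSubring K) (hUW : U ≤ W)
    (hdom : ∀ m : ℕ, ∀ s ∈ tower O A m, s ∈ U ∧ (s⁻¹ ∈ U → s⁻¹ ∈ O)) (hesc : ∃ m : ℕ, ∃ s ∈ tower O A m, s⁻¹ ∈ W ∧ s⁻¹ ∉ O)
    (hacc : ∀ z : ℕ → K, (∀ n : ℕ, (∃ m : ℕ, z n ∈ tower O A m) ∧ z n ≠ 0 ∧ (z n)⁻¹ ∈ W) →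
      (∀ n : ℕ, z n * (z (n + 1))⁻¹ ∈ U) → ∃ n : ℕ, z (n + 1) * (z n)⁻¹ ∈ U) :
    ∃ m : ℕ, IsRegularLocalRing ↥(tower O A m) := by
  classical
  by_cases h0 : IsRegularLocalRing ↥(tower O A 0)
  · exact ⟨0, h0⟩
  have hPR : ∀ m : ℕ, ∀ x ∈ ca (tower O A m), ∃ N : ℕ, 1 ≤ N ∧ x ^ N ∈ ca (tower O A (m + 1)) :=
    hP p hp k K O A hk hA hfr hAO
  have hdrop : ∀ m : ℕ, ¬ IsRegularLocalRing ↥(tower O A m) → ∃ m' : ℕ, m < m' ∧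
      ∃ y ∈ ca (tower O A m'), y ≠ 0 ∧ ∀ x ∈ ca (tower O A m), x ≠ 0 → y * x⁻¹ ∉ O :=
    hD p hp k K O A hk hA hfr hAO
  have hne : ∃ m, ∃ x ∈ ca (tower O A m), x ≠ 0 := by
    obtain ⟨m', -, y, hy, hy0, -⟩ := hdrop 0 h0
    exact ⟨m', y, hy, hy0⟩
  -- dominance invariance: the `U`-tower IS the `O`-tower
  have hinv : ∀ m : ℕ, tower U A m = tower O A m :=
    stub_dominanceInvariance k K O U A hk hAO (stub_towerNoetherian k K O A hk hA hfr hAO) hdom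
  -- CT for `W` relative to `O`
  obtain ⟨M, c, hc, hc0, hcW⟩ := Coarsening.unitCreating_of_noThread O A hk hA hfr hAO hPR hne hthr W hesc
  -- the datum `(U, A)`
  have hA0 : A ≤ tower O A 0 := (tn_tower_invariant O A hk hA hfr hAO 0).1
  have hkU : ∀ c : k, algebraMap k K c ∈ U := fun c => (hdom 0 _ (hA0 (A.algebraMap_mem c))).1
  have hAU : A.toSubring ≤ U.toSubring := fun x hx => (hdom 0 x (hA0 hx)).1
  have hunit : ∃ c ∈ ca (tower U A M), c ≠ 0 ∧ c⁻¹ ∈ W := by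
    rw [hinv M]; exact ⟨c, hc, hc0, hcW⟩
  have hacc' : ∀ z : ℕ → K,
      (∀ n : ℕ, (∃ m : ℕ, M ≤ m ∧ z n ∈ ca (tower U A m)) ∧ z n ≠ 0 ∧ (z n)⁻¹ ∈ W) →
      (∀ n : ℕ, z n * (z (n + 1))⁻¹ ∈ U) → ∃ n : ℕ, z (n + 1) * (z n)⁻¹ ∈ U := by
    intro z hz hch
    refine hacc z (fun n => ?_) hch
    obtain ⟨⟨m, -, hzm⟩, hz0, hzW⟩ := hz n
    rw [hinv m] at hzm
    exact ⟨⟨m, ca_subset _ hzm⟩, hz0, hzW⟩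
  obtain ⟨m, hm⟩ := Coarsening.relativeACC_tower hD p hp k K U A hkU hA hfr hAU W hUW M hunit hacc'
  rw [hinv m] at hm
  exact ⟨m, hm⟩

/-! ## Residues of `W`-units -/

/-- Residues of `W`-units are non-zero. [folklore; r11] -/
theorem residue_ne_zero_of_inv_mem (W : ValuationSubring K) {x : K} (hx : x ∈ W) (hxi : x⁻¹ ∈ W)
    (hx0 : x ≠ 0) : residue W ⟨x, hx⟩ ≠ 0 := by
  intro h
  have h1 : residue W ⟨x⁻¹, hxi⟩ * residue W ⟨x, hx⟩ = 1 := by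
    rw [← map_mul, ← map_one (residue W)]
    congr 1
    exact Subtype.ext (inv_mul_cancel₀ hx0)
  rw [h, mul_zero] at h1
  exact zero_ne_one h1

/-- Residue of a quotient by a `W`-unit. [folklore; r11] -/
theorem residue_mul_inv (W : ValuationSubring K) {x y : K} (hx : x ∈ W) (hy : y ∈ W) (hyi : y⁻¹ ∈ W)
    (hy0 : y ≠ 0) (hxy : x * y⁻¹ ∈ W) :
    residue W ⟨x * y⁻¹, hxy⟩ = residue W ⟨x, hx⟩ * (residue W ⟨y, hy⟩)⁻¹ := by
  have e : (⟨x * y⁻¹, hxy⟩ : W) = ⟨x, hx⟩ * ⟨y⁻¹, hyi⟩ := Subtype.ext rfl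
  rw [e, map_mul, residue_mk_inv W hy hyi hy0]

/-! ## §r12.4 (PROVED, r11) The composite `U = W ∘ Ū = residueOverringLift W Ū` dominates the tower -/

/-- **DOMINATION UPSTAIRS (PROVED, r11 verbatim).** [this work] -/
theorem dominates_residueLift (O : ValuationSubring K) (A : Subalgebra k K) (W : ValuationSubring K)
    (Ū : ValuationSubring (ResidueField W))
    (hW : ∀ m : ℕ, ∀ s ∈ tower O A m, s ∈ W)
    (hres : ∀ (m : ℕ) (s : K) (hs : s ∈ tower O A m), residue W ⟨s, hW m s hs⟩ ∈ Ū)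
    (hdom : ∀ (m : ℕ) (s : K) (hs : s ∈ tower O A m), s⁻¹ ∈ W →
      (residue W ⟨s, hW m s hs⟩)⁻¹ ∈ Ū → s⁻¹ ∈ O) :
    ∀ m : ℕ, ∀ s ∈ tower O A m, s ∈ residueOverringLift W Ū ∧
      (s⁻¹ ∈ residueOverringLift W Ū → s⁻¹ ∈ O) := by
  intro m s hs
  refine ⟨(mem_residueOverringLift_iff W Ū s).2 ⟨hW m s hs, hres m s hs⟩, fun hsi => ?_⟩
  rcases eq_or_ne s 0 with rfl | hs0
  · rw [inv_zero]; exact O.zero_mem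
  obtain ⟨hsiW, hsiU⟩ := (mem_residueOverringLift_iff W Ū s⁻¹).1 hsi
  refine hdom m s hs hsiW ?_
  rw [← residue_mk_inv W (hW m s hs) hsiW hs0]
  exact hsiU

/-! ## §r12.5 The TRACE FIELD and the chain transfer -/

/-- **`hacc` UPSTAIRS from the chain condition on TRACE chains (PROVED).**  If `Ū` has the descending chain
condition on chains of non-zero elements lying in a subset `F ⊆ κ(W)`, then the composite `W ∘ Ū` has the chain
binder of the stage-chain terminator on chains of `W`-units whose residues lie in `F`. [this work] -/
theorem hacc_of_traceChains (W : ValuationSubring K) (Ū : ValuationSubring (ResidueField W))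
    (F : Set (ResidueField W))
    (hdisc : ∀ r : ℕ → ResidueField W, (∀ n, r n ∈ F) → (∀ n, r n ∈ Ū ∧ r n ≠ 0) →
      (∀ n, r n * (r (n + 1))⁻¹ ∈ Ū) → ∃ n, r (n + 1) * (r n)⁻¹ ∈ Ū)
    (z : ℕ → K) (hz : ∀ n : ℕ, z n ∈ residueOverringLift W Ū ∧ z n ≠ 0 ∧ (z n)⁻¹ ∈ W)
    (hzF : ∀ n : ℕ, ∃ h : z n ∈ W, residue W ⟨z n, h⟩ ∈ F)
    (hch : ∀ n : ℕ, z n * (z (n + 1))⁻¹ ∈ residueOverringLift W Ū) :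
    ∃ n : ℕ, z (n + 1) * (z n)⁻¹ ∈ residueOverringLift W Ū := by
  have hzW : ∀ n, z n ∈ W := fun n => residueOverringLift_le W Ū (hz n).1
  let r : ℕ → ResidueField W := fun n => residue W ⟨z n, hzW n⟩
  have hrF : ∀ n, r n ∈ F := fun n => by
    obtain ⟨h, hF⟩ := hzF n
    exact hF
  have hrU : ∀ n, r n ∈ Ū ∧ r n ≠ 0 := fun n => by
    refine ⟨?_, residue_ne_zero_of_inv_mem W (hzW n) (hz n).2.2 (hz n).2.1⟩
    obtain ⟨h1, h2⟩ := (mem_residueOverringLift_iff W Ū (z n)).1 (hz n).1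
    exact h2
  have hrch : ∀ n, r n * (r (n + 1))⁻¹ ∈ Ū := fun n => by
    obtain ⟨h1, h2⟩ := (mem_residueOverringLift_iff W Ū _).1 (hch n)
    rw [residue_mul_inv W (hzW n) (hzW (n + 1)) (hz (n + 1)).2.2 (hz (n + 1)).2.1 h1] at h2
    exact h2
  obtain ⟨n, hn⟩ := hdisc r hrF hrU hrch
  have hmem : z (n + 1) * (z n)⁻¹ ∈ W := W.mul_mem _ _ (hzW (n + 1)) (hz n).2.2
  refine ⟨n, (mem_residueOverringLift_iff W Ū _).2 ⟨hmem, ?_⟩⟩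
  rw [residue_mul_inv W (hzW (n + 1)) (hzW n) (hz n).2.2 (hz n).2.1 hmem]
  exact hn

/-- **NOETHERIAN ⇒ chain condition (PROVED, r11).**  ACC on the principal ideals `(rₙ)`. [folklore] -/
theorem chain_of_isNoetherianRing {L : Type} [Field L] (V : ValuationSubring L) (hN : IsNoetherianRing V)
    (r : ℕ → L) (hr : ∀ n, r n ∈ V ∧ r n ≠ 0) (hch : ∀ n, r n * (r (n + 1))⁻¹ ∈ V) :
    ∃ n, r (n + 1) * (r n)⁻¹ ∈ V := by
  let e : ℕ → V := fun n => ⟨r n, (hr n).1⟩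
  have hmono : Monotone fun n => Ideal.span ({e n} : Set V) := by
    refine monotone_nat_of_le_succ fun n => ?_
    rw [Ideal.span_singleton_le_iff_mem, Ideal.mem_span_singleton']
    refine ⟨⟨r n * (r (n + 1))⁻¹, hch n⟩, Subtype.ext ?_⟩
    change r n * (r (n + 1))⁻¹ * r (n + 1) = r n
    rw [inv_mul_cancel_right₀ (hr (n + 1)).2]
  haveI : IsNoetherian V V := hN
  obtain ⟨n, hn⟩ := monotone_stabilizes_iff_noetherian.2 ‹IsNoetherian V V› ⟨_, hmono⟩
  refine ⟨n, ?_⟩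
  have hle : Ideal.span ({e (n + 1)} : Set V) ≤ Ideal.span {e n} := (hn (n + 1) (Nat.le_succ n)).symm.le
  rw [Ideal.span_singleton_le_iff_mem, Ideal.mem_span_singleton'] at hle
  obtain ⟨a, ha⟩ := hle
  have h : (a : L) * r n = r (n + 1) := by
    have := congrArg (fun z : V => (z : L)) ha
    simpa using this
  have : r (n + 1) * (r n)⁻¹ = (a : L) := by
    rw [← h, mul_inv_cancel_right₀ (hr n).2]
  rw [this]
  exact a.2

/-- **TRACE CHAINS (PROVED).**  If the TRACE `V = Ū ∩ F` of `Ū` on an intermediate field `F` of `κ(W)/k` is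
noetherian, `Ū` has the descending chain condition on chains in `F`. [this work] -/
theorem chain_of_noetherianTrace {L : Type} [Field L] [Algebra k L] (Ū : ValuationSubring L)
    (F : IntermediateField k L) (hN : IsNoetherianRing ↥(Ū.comap (algebraMap F L)))
    (r : ℕ → L) (hrF : ∀ n, r n ∈ F) (hr : ∀ n, r n ∈ Ū ∧ r n ≠ 0)
    (hch : ∀ n, r n * (r (n + 1))⁻¹ ∈ Ū) : ∃ n, r (n + 1) * (r n)⁻¹ ∈ Ū := by
  set V := Ū.comap (algebraMap F L) with hV
  let r' : ℕ → F := fun n => ⟨r n, hrF n⟩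
  have hr' : ∀ n, r' n ∈ V ∧ r' n ≠ 0 := fun n => by
    refine ⟨?_, fun h => (hr n).2 ?_⟩
    · rw [hV, ValuationSubring.mem_comap, IntermediateField.algebraMap_apply]; exact (hr n).1
    · have := congrArg (fun x : F => (x : L)) h
      simpa [r'] using this
  have hch' : ∀ n, r' n * (r' (n + 1))⁻¹ ∈ V := fun n => by
    rw [hV, ValuationSubring.mem_comap, map_mul, map_inv₀, IntermediateField.algebraMap_apply,
      IntermediateField.algebraMap_apply]
    exact hch n
  obtain ⟨n, hn⟩ := chain_of_isNoetherianRing V hN r' hr' hch'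
  refine ⟨n, ?_⟩
  rw [hV, ValuationSubring.mem_comap, map_mul, map_inv₀, IntermediateField.algebraMap_apply,
    IntermediateField.algebraMap_apply] at hn
  exact hn

/-- **ONE-VARIABLE TRACES ARE DISCRETE (PROVED from the tree).**  A valuation ring `Ū ∋ k` of `L ⊇ F ⊇ k` which
misses the inverse of some element of `F` has NOETHERIAN trace on `F` when `F/k` is a finitely generated field of
transcendence degree `≤ 1`: the trace is a proper valuation ring of `F` containing `k`, hence a DVR (tree
`isDiscreteValuationRing_of_primeDivisor`, `n = 0`). [this work; ZariskiSamuel1960 VI §14 Thm 31 via the tree] -/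
theorem isNoetherianRing_trace_of_curve {L : Type} [Field L] [Algebra k L] (Ū : ValuationSubring L)
    (F : IntermediateField k L) (hkU : ∀ c : k, algebraMap k L c ∈ Ū)
    {x : L} (hxF : x ∈ F) (hxi : x⁻¹ ∉ Ū)
    (hfg : (⊤ : IntermediateField k F).FG) (htr : Algebra.trdeg k ↥F ≤ 1) :
    IsNoetherianRing ↥(Ū.comap (algebraMap F L)) := by
  set V := Ū.comap (algebraMap F L) with hV
  have hkV : ∀ c : k, algebraMap k F c ∈ V := fun c => by
    rw [hV, ValuationSubring.mem_comap, ← IsScalarTower.algebraMap_apply]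
    exact hkU c
  letI : Algebra k V := algebraOfMem k V hkV
  haveI : IsScalarTower k V F := isScalarTower_algebraOfMem k V hkV
  have hVtop : V ≠ ⊤ := by
    intro h
    apply hxi
    have hmem : (⟨x, hxF⟩ : F)⁻¹ ∈ V := by rw [h]; exact ValuationSubring.mem_top _
    rw [hV, ValuationSubring.mem_comap, map_inv₀, IntermediateField.algebraMap_apply] at hmem
    exact hmem
  haveI : IsDiscreteValuationRing V :=
    isDiscreteValuationRing_of_primeDivisor V hfg hVtop (n := 0) (fun i => Fin.elim0 i)
      (algebraicIndependent_empty_type_iff.mpr (algebraMap k (ResidueField V)).injective)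
      (by simpa using htr)
  infer_instance


end Summit.ResolutionOfSingularities.ResolutionOfSingularities.Theorems.NoZeno.TraceSocle

end
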